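import Summits.BirchSwinnertonDyer.Rank1Residual.Additive.TameBranchLower
import HarnessLib

/-!
# Class N10, potentially-ORDINARY locus, Λ-level, the UPPER (Kato-direction) twin at `T = 0` of
# `Additive/TameBranchLower.lean`: `p`-integrality of E's plus symbols at every cusp (census H-2(b),
# TYPED) and "rational tame-branch main conjecture + `μ^alg = 0` + integrality ⟹ `CycLeadingTermAt`"
# (cell `b2b-bsdres`, lane CLASS-CLOSURE, seat cc-typer-2; n1011 lead R5 'H-2(b): your call')

HONEST FRAMING (cell `b2b-bsdres`, run/shared/lean/b2b/bsd-rank1-residual/, verbatim in every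
file): the goal of the cell is to DELETE the COMBINATION-SHAPED residual classes of the
Birch–Swinnerton-Dyer formula for ALL analytic-rank `≤ 1` elliptic curves over `ℚ` — "full BSD
formula for every rank `≤ 1` curve in class `C`" assembled STRICTLY from published theorems — so
that the rank-`≤ 1` remainder becomes exactly the CONSTRUCTION-SHAPED classes, which are TYPED
(missing-input `Prop`s), NOT attempted. This is not "finishing BSD". Lane CLASS-CLOSURE: research
routes, no claim beyond the stated classes; census output = EVIDENCE / conjecture items, NEVER a
Literature fact; N10 stays CONSTRUCTION-shaped; NOTHING is booked. One definition (a typed input)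
and bookkeeping theorems; no named fact; every published input is an explicit binder.

## What and why

`TameBranchLower.lean` typed the tame-branch main conjecture at an additive potentially-ordinary
prime as a RATIONAL equality `ι g = p^k · B_E` (`TameBranchRatCharEqAt W p`) and showed that a
unit-coefficient certificate on the E-normalised branch `B_E` forces `k ≥ 0`, whence the
main-conjecture-direction input `CycLeadingTermDvdAt` (LOWER half). This sibling records the UPPER
twin: if `char_Λ X(E/ℚ_∞)` has `μ = 0` (Greenberg's conjecture for irreducible `E[p]`; a binder)
and `B_E` has `p`-INTEGRAL coefficients, then `k ≤ 0`
(`exponent_nonpos_of_hasUnitContent_of_integral`), and with the `T = 0` period binder as a unit the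
element `p^{−k}·g ∈ char_Λ X(E/ℚ_∞)` has constant term `u · L(E,1)/Ω_E`: additive-p2's
`CycLeadingTermAt W p` (Delbourgo 1998 Main Conjecture (G)/(M), divisibility direction, at `T = 0`),
whose consumers (`GordCycLeadingTerm.lean`) give the upper half `ord_p #Ш ≤ ord_p #Ш_an` on the whole
(G)-ordinary cell — on the defect-`3,4,6` corner this was the located gap "canonical-vs-Néron period
comparison for `f̃` not in print". The integrality of `B_E` is E-INTRINSIC: by census-ctyper1's
squeeze (`CensusX43TwistSqueeze.exists_forall_norm_le_norm_twist`,
`CensusX43ValueModule.valueModuleLevelEq_of_hasOrdinaryTwistPartner`) the sup norm of an ordinary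
twist partner `Φ` of `f_E` equals the sup norm of E's own plus symbols `[·]⁺_{f_E}`, so
"`B_E ∈ Λ`" ⟸ "`|[x]⁺_{f_E}|_p ≤ 1` for EVERY `x ∈ ℚ`" — typed here as `PlusSymbolsPIntegralAt W p`
(census H-2 (b), routed to this seat by the n1011 lead, R5). The tree PROVES the coprime-denominator
case under irreducible `E[p]` (`IsNewformOf.norm_ratPlusSymbol_le_one`); the `p`-power cusps at an
additive `p` are the content (census X4-3, W1: 137/142 typeG rows, the 5 failures being exactly the
5 `p`-isogeny rows). Nothing here is a theorem about elliptic curves beyond bookkeeping.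

References: HOME/cells/n1011/ROUTE-2.md §II; census-ctyper1 INBOX 2026-08-21T06:30Z (H-2);
Delbourgo 1998 Main Conjecture p. 151 [Delbourgo1998]; Mazur–Tate–Teitelbaum 1986 §I.13–I.14
[MazurTateTeitelbaum1986Invent]; Greenberg–Vatsal 2000 (1)–(2), Prop. 3.7 [GreenbergVatsal2000];
Kim 2022 §1.4.1 [Kim2022StructureSelmer].
-/

noncomputable section

open scoped Classical MatrixGroups ModularForm NumberField

open CongruenceSubgroup WeierstrassCurve NumberField Literature.NumberTheory.EllipticCurves
  Literature.NumberTheory.EllipticCurves.ModularForms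
  Literature.NumberTheory.EllipticCurves.Rank1Residual
  Literature.NumberTheory.EllipticCurves.Rank1Residual.Typed
  IsDedekindDomain

namespace Summit.BirchSwinnertonDyer.Rank1Residual.Additive

/-! ### §4 The UPPER twin at `T = 0` (census H-2(b)): the rational main conjecture + `μ^alg = 0` +
`p`-INTEGRALITY of the E-normalised branch ⟹ exponent `k ≤ 0` ⟹ `CycLeadingTermAt` -/

section Upper

variable (W : WeierstrassCurve ℚ) [W.IsElliptic] [W.IsGloballyMinimal] (p : ℕ) [hp : Fact p.Prime]

/-- **`p`-integrality of E's plus modular symbols at EVERY cusp, TYPED** (census H-2(b); the UPPER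
period-half on N10's corner). For the newform `f` of `W` and every `x ∈ ℚ`: `|[x]⁺_f|_p ≤ 1`
(`[x]⁺_f = ratPlusSymbol f x`, `Ω⁺_f`-normalised). The tree PROVES it for `den(x)` coprime to the
level when `E[p]` is irreducible (`IsNewformOf.norm_ratPlusSymbol_le_one`, Stevens / Greenberg–Vatsal
Prop. 3.7 / Kim 2022 §1.4.1); at an ADDITIVE `p` the cusps `b/p^m` are the content. By
census-ctyper1's squeeze (`CensusX43TwistSqueeze`, `CensusX43ValueModule.valueModuleLevelEq_of_hasOrdinaryTwistPartner`)
it is equivalent, given an ordinary twist partner `Φ`, to `∀ s, |Φ(s)|_p ≤ 1`, hence to the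
`p`-integrality of the E-normalised tame branch `B_E` of §1; EVIDENCE (census X4-3, W1, 142 typeG
rows `N ≤ 2350`): holds on 137/142, fails exactly on the 5 `p`-isogeny rows (294a1@7, 450a1@5,
490f1@7, 1200q1@5, 1575k1@5) — so CONJECTURED on X4 (irreducible `E[p]`); plausibly a theorem on
X4 ∧ surj(`p`) (cuspidal divisor classes are torsion, Manin–Drinfeld, and `E(ℚ(μ_{p^∞}))[p] = 0`) — a
named prover target, not claimed. A predicate on `(W, p)`; nothing asserted.
[cite: Kim2022StructureSelmer, §1.4.1 (PDF p. 7) (the coprime-denominator case; shape)] -/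
def PlusSymbolsPIntegralAt (W : WeierstrassCurve ℚ) (p : ℕ) [Fact p.Prime] : Prop :=
  ∀ {N : ℕ} [NeZero N] (f : CuspForm (Gamma0 N) 2), IsNewformOf W f →
    ∀ x : ℚ, ‖((ratPlusSymbol f x : ℚ) : ℚ_[p])‖ ≤ 1

/-- **Exponent `≤ 0` from unit content and integrality.** If `ι g = p^k · B` with `g ∈ Λ` of unit
content (`μ(g) = 0`: some coefficient of `g` is a unit) and `B` has `p`-integral coefficients, then
`k ≤ 0` — the mirror of `X9.exponent_nonneg_of_exists_norm_coeff_eq_one`. Pure algebra. [folklore] -/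
theorem exponent_nonpos_of_hasUnitContent_of_integral (g : IwasawaAlgebra p) (B : PowerSeries ℚ_[p])
    (k : ℤ) (h : iwasawaToPowerSeries p g = PowerSeries.C ((p : ℚ_[p]) ^ k) * B)
    (hμ : GreenbergVatsal2000.HasUnitContent g) (hint : ∀ n : ℕ, ‖PowerSeries.coeff n B‖ ≤ 1) :
    k ≤ 0 := by
  have hpP : p.Prime := hp.out
  have hp1 : (1 : ℝ) < p := by exact_mod_cast hpP.one_lt
  obtain ⟨n, hn⟩ := (GreenbergVatsal2000.hasUnitContent_iff_exists_norm_coeff_map_eq_one g).mp hμ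
  have hn' := congrArg (PowerSeries.coeff n) h
  rw [PowerSeries.coeff_C_mul] at hn'
  rw [hn', norm_mul, norm_zpow, Padic.norm_p, inv_zpow', zpow_neg] at hn
  by_contra hk
  rw [not_le] at hk
  have hlt : ((p : ℝ) ^ k)⁻¹ < 1 := inv_lt_one_of_one_lt₀ (one_lt_zpow₀ hp1 hk)
  have h0 : (0 : ℝ) ≤ ((p : ℝ) ^ k)⁻¹ := by positivity
  have : ((p : ℝ) ^ k)⁻¹ * ‖PowerSeries.coeff n B‖ < 1 :=
    lt_of_le_of_lt (mul_le_of_le_one_right h0 (hint n)) hlt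
  linarith

/-- **The Kato-direction `T = 0` input `CycLeadingTermAt W p` from the rational tame-branch main
conjecture, UPPER twin of `cycLeadingTermDvdAt_of_tameBranchRatCharEq_of_unitCoeff`.** Inputs:
`TameBranchRatCharEqAt W p`, a tame-branch tuple `(f, ε, α, B)`, Greenberg's `μ^alg(E/ℚ_∞) = 0`
(`hμ`: every generator of `char_Λ X(W/ℚ_∞)` has unit content — CONJECTURAL, a binder), the
`p`-integrality of `B` (`hint` — the E-intrinsic form of `PlusSymbolsPIntegralAt`, census H-2(b)),
and the `T = 0` period binder in the UPPER direction as a UNIT: `α⁻¹·[0]⁺_f = u·q`, `u ∈ ℤ_pˣ`,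
`L(E,1) = q·Ω_E`. Then the exponent is `k ≤ 0` and `p^{−k}·g ∈ char_Λ X(W/ℚ_∞)` has constant term
`u·q` — additive-p2's `CycLeadingTermAt W p` (Delbourgo 1998 Main Conjecture (G)/(M), divisibility
direction, at `T = 0`), whose consumers give the UPPER half on the whole (G-ordinary) cell
(`GordCycLeadingTerm.lean`). Bookkeeping; nothing asserted about elliptic curves beyond the binders.
[cite: Delbourgo1998, Main Conjecture (p. 151) (shape; divisibility direction at `T = 0`)]
[cite: MazurTateTeitelbaum1986Invent, §I.13–I.14 (constant term; shape)] -/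
theorem cycLeadingTermAt_of_tameBranchRatCharEq_of_hasUnitContent_of_integral
    (hT : TameBranchRatCharEqAt W p)
    {N : ℕ} [NeZero N] {f : CuspForm (Gamma0 N) 2} {ε : DirichletCharacter ℂ_[p] p} {α : ℚ_[p]}
    {B : PowerSeries ℚ_[p]}
    (hp2 : p ≠ 2) (hadd : Addv W p) (hloc : PotMult W p ∨ TypeGOrd W p)
    (hf : IsNewformOf W f) (hε : orderOf ε = tameDefect W p) (hα : ‖α‖ = 1)
    (hB : IsTameBranchOf f p ε α B)
    (hμ : ∀ (κ : ZpExtension ℚ p) (γ : Field.absoluteGaloisGroup ℚ),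
      κ.IsCyclotomic → κ.IsTopGenerator γ → IsCyclotomicVariable p γ →
      ∀ (D : W.SelmerDualData κ γ) (g : IwasawaAlgebra p), D.charIdeal = Ideal.span {g} →
        GreenbergVatsal2000.HasUnitContent g)
    (hint : ∀ n : ℕ, ‖PowerSeries.coeff n B‖ ≤ 1)
    {q : ℚ} (hq : W.entireLFunction 1 = (q : ℂ) * (W.realPeriodRat : ℂ))
    {u : ℤ_[p]ˣ} (hu : α⁻¹ * (ratPlusSymbol f 0 : ℚ_[p]) = ((u : ℤ_[p]) : ℚ_[p]) * (q : ℚ_[p])) :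
    CycLeadingTermAt W p := by
  intro κ γ hκ hγ hcv D
  obtain ⟨-, g, k, hspan, hιg⟩ := hT ε α B hp2 hadd hloc hκ hγ hcv hf hε hα hB D
  have hk : k ≤ 0 :=
    exponent_nonpos_of_hasUnitContent_of_integral p g B k hιg (hμ κ γ hκ hγ hcv D g hspan) hint
  obtain ⟨k', hk'⟩ : ∃ k' : ℕ, k = -(k' : ℤ) := ⟨(-k).toNat, by omega⟩
  have h0g := congrArg PowerSeries.constantCoeff hιg
  rw [constantCoeff_iwasawaToPowerSeries, map_mul, PowerSeries.constantCoeff_C,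
    hB.constantCoeff, hu] at h0g
  refine ⟨PowerSeries.C ((p : ℤ_[p]) ^ k') * g, ?_, u, q, hq, ?_⟩
  · rw [hspan]
    exact Ideal.mul_mem_left _ _ (Ideal.mem_span_singleton_self g)
  · have hpne : (p : ℚ_[p]) ≠ 0 := by exact_mod_cast hp.out.ne_zero
    rw [map_mul, PowerSeries.constantCoeff_C, PadicInt.coe_mul, h0g, hk', zpow_neg, zpow_natCast]
    push_cast
    rw [← mul_assoc, ← mul_assoc, mul_inv_cancel₀ (pow_ne_zero _ hpne), one_mul]

end Upper

end Summit.BirchSwinnertonDyer.Rank1Residual.Additive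

end
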